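import Summits.CriticalPhenomena.PercolationContinuityZ3.Theorems.Transplant.FKDoubleFanWordCellsRoofCtrl
import Summits.CriticalPhenomena.PercolationContinuityZ3.Theorems.Transplant.FKDoubleFanD3Core111Stage
import HarnessLib

/-!
# Double fans, distance 3 below `q = 1/2` (MIN pattern): the TERMWISE cells, part 3 — pairs `(AC,R₀)`, `(AC,R₁)`, `(AC,𝟙)`, `(𝟙,𝟙)`, `(𝟙,AC)` of the 8 T/I words

Helper file (`--supports stmt-CriticalPhenomena-4575`), FK sub-lane `prim-bschramm-fk-3` (gen 52); builds on p205010 (kernel theorem, internal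
audit signed; external expert review pending).  Pure real algebra; no named facts, no sorries, default heartbeats; standard axioms.  Memo
`bschramm/prim-bschramm-fk-3/FAR-CROSS-XXVII.md` §0(A).

Below `q = 1/2` the rim-polarized cells of the two-block MIN pattern `E B_y E A_x E` are negative only at the pairs `(AC,AC)` (treated rim-unsplit in
«…LowQMinACAC») and `(𝟙,R_*)`, `(R_*,𝟙)`, `(R_*,R_*)` (the whole-roof block).  Every other pair of the core `{AC, 𝟙, roof}²` is termwise non-negative:
this file certifies, for each of the 8 words `κ ∈ {T,I}³` and the pairs `(AC,R₀(ws))`, `(AC,R₁(ws))`, `(AC,𝟙)`, `(𝟙,𝟙)`, `(𝟙,AC)`, the inequality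
`0 ≤ pcell2 q κ 0 y x 0 P S` on `q ∈ [0,1/2]`, spokes and probe in `[0,1]`, by an explicit tensor-Bernstein certificate in `(2q, y, x, ws)` after
removing the vanishing linear factors (the mirror pairs `(R_*,AC)` follow by `pcell2_mirror`, the W-words by `partsOK_of_hasW`).
[folklore]
-/

noncomputable section

namespace Summit.CriticalPhenomena.PercolationContinuityZ3.Theorems

namespace FK

namespace ThreeApex

/-- MIN word `(2, 2, 1)`, pair `(AC, R0)`: `≥ 0` on `q ∈ [0,1/2]` (termwise Bernstein certificate, 7 coefficients after removing ['(1 - q)', '(2 - q)', '(1 - y)', '(1 - x)']). [folklore] -/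
theorem lqMin_AC_R0_221 {q y x ws : ℝ} (hq0 : 0 ≤ q) (hq1 : q ≤ 1 / 2) (_hy0 : 0 ≤ y) (_hy1 : y ≤ 1) (_hx0 : 0 ≤ x) (_hx1 : x ≤ 1) (_hws0 : 0 ≤ ws) (_hws1 : ws ≤ 1) :
    0 ≤ pcell2 q 2 2 1 0 y x 0 rayAC (roofR0 q ws) := by
  have hu : (0:ℝ) ≤ 2 * q := by linarith
  have huc : (0:ℝ) ≤ 1 - 2 * q := by linarith
  have hq1c : (0:ℝ) ≤ 1 - q := by linarith
  have hq2c : (0:ℝ) ≤ 2 - q := by linarith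
  have hyc : (0:ℝ) ≤ 1 - y := by linarith
  have hxc : (0:ℝ) ≤ 1 - x := by linarith
  have hwsc : (0:ℝ) ≤ 1 - ws := by linarith
  have g0 : 0 ≤ (2:ℝ) * (1 - 2 * q) * (1 - y) * ws * (1 - ws) + (1:ℝ) * (1 - 2 * q) * (1 - y) * ws ^ (2:ℕ) + ((1:ℝ)/2) * (2 * q) * (1 - y) * (1 - ws) ^ (2:ℕ) + (2:ℝ) * (2 * q) * (1 - y) * ws * (1 - ws) + ((1:ℝ)/2) * (2 * q) * (1 - y) * ws ^ (2:ℕ) + ((1:ℝ)/2) * (2 * q) * y * (1 - ws) ^ (2:ℕ) + (1:ℝ) * (2 * q) * y * ws * (1 - ws) := by positivity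
  have hR : 0 ≤ (2:ℝ) * ws - (ws ^ (2:ℕ)) + (-2:ℝ) * y * ws + y * ws ^ (2:ℕ) + q + (-2:ℝ) * q * ws + (2:ℝ) * q * y * ws - (q * y * ws ^ (2:ℕ)) := by
    have e : (2:ℝ) * ws - (ws ^ (2:ℕ)) + (-2:ℝ) * y * ws + y * ws ^ (2:ℕ) + q + (-2:ℝ) * q * ws + (2:ℝ) * q * y * ws - (q * y * ws ^ (2:ℕ)) =
      ((2:ℝ) * (1 - 2 * q) * (1 - y) * ws * (1 - ws) + (1:ℝ) * (1 - 2 * q) * (1 - y) * ws ^ (2:ℕ) + ((1:ℝ)/2) * (2 * q) * (1 - y) * (1 - ws) ^ (2:ℕ) + (2:ℝ) * (2 * q) * (1 - y) * ws * (1 - ws) + ((1:ℝ)/2) * (2 * q) * (1 - y) * ws ^ (2:ℕ) + ((1:ℝ)/2) * (2 * q) * y * (1 - ws) ^ (2:ℕ) + (1:ℝ) * (2 * q) * y * ws * (1 - ws)) := by ring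
    rw [e]; linarith [g0]
  have e2 : pcell2 q 2 2 1 0 y x 0 rayAC (roofR0 q ws) =
      ((1 - q) * (2 - q) * (1 - y) * (1 - x)) * ((2:ℝ) * ws - (ws ^ (2:ℕ)) + (-2:ℝ) * y * ws + y * ws ^ (2:ℕ) + q + (-2:ℝ) * q * ws + (2:ℝ) * q * y * ws - (q * y * ws ^ (2:ℕ))) := by
    simp only [pcell2, rimOp, opAC, opBC, opTD, opTa, opWa, opTb, opWb, Biv.lin3, Biv.add, Biv.smul, inputBiv, targetBiv, pairH, rayAC, roofR0, xwR, zwR]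
    ring
  rw [e2]; exact mul_nonneg (mul_nonneg (mul_nonneg (mul_nonneg hq1c hq2c) hyc) hxc) hR

/-- MIN word `(2, 2, 1)`, pair `(AC, R1)`: `≥ 0` on `q ∈ [0,1/2]` (termwise Bernstein certificate, 8 coefficients after removing ['(1 - q)', '(2 - q)', '(1 - y)', '(1 - x)']). [folklore] -/
theorem lqMin_AC_R1_221 {q y x ws : ℝ} (hq0 : 0 ≤ q) (hq1 : q ≤ 1 / 2) (_hy0 : 0 ≤ y) (_hy1 : y ≤ 1) (_hx0 : 0 ≤ x) (_hx1 : x ≤ 1) (_hws0 : 0 ≤ ws) (_hws1 : ws ≤ 1) :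
    0 ≤ pcell2 q 2 2 1 0 y x 0 rayAC (roofR1 q ws) := by
  have hu : (0:ℝ) ≤ 2 * q := by linarith
  have huc : (0:ℝ) ≤ 1 - 2 * q := by linarith
  have hq1c : (0:ℝ) ≤ 1 - q := by linarith
  have hq2c : (0:ℝ) ≤ 2 - q := by linarith
  have hyc : (0:ℝ) ≤ 1 - y := by linarith
  have hxc : (0:ℝ) ≤ 1 - x := by linarith
  have hwsc : (0:ℝ) ≤ 1 - ws := by linarith
  have g0 : 0 ≤ (2:ℝ) * (1 - 2 * q) * (1 - y) * ws * (1 - ws) + (2:ℝ) * (1 - 2 * q) * (1 - y) * ws ^ (2:ℕ) + (1:ℝ) * (2 * q) * (1 - y) * (1 - ws) ^ (2:ℕ) + (3:ℝ) * (2 * q) * (1 - y) * ws * (1 - ws) + ((3:ℝ)/2) * (2 * q) * (1 - y) * ws ^ (2:ℕ) + (1:ℝ) * (2 * q) * y * (1 - ws) ^ (2:ℕ) + (2:ℝ) * (2 * q) * y * ws * (1 - ws) + ((1:ℝ)/2) * (2 * q) * y * ws ^ (2:ℕ) := by positivity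
  have hR : 0 ≤ (2:ℝ) * ws + (-2:ℝ) * y * ws + (2:ℝ) * q + (-2:ℝ) * q * ws - (q * ws ^ (2:ℕ)) + (2:ℝ) * q * y * ws := by
    have e : (2:ℝ) * ws + (-2:ℝ) * y * ws + (2:ℝ) * q + (-2:ℝ) * q * ws - (q * ws ^ (2:ℕ)) + (2:ℝ) * q * y * ws =
      ((2:ℝ) * (1 - 2 * q) * (1 - y) * ws * (1 - ws) + (2:ℝ) * (1 - 2 * q) * (1 - y) * ws ^ (2:ℕ) + (1:ℝ) * (2 * q) * (1 - y) * (1 - ws) ^ (2:ℕ) + (3:ℝ) * (2 * q) * (1 - y) * ws * (1 - ws) + ((3:ℝ)/2) * (2 * q) * (1 - y) * ws ^ (2:ℕ) + (1:ℝ) * (2 * q) * y * (1 - ws) ^ (2:ℕ) + (2:ℝ) * (2 * q) * y * ws * (1 - ws) + ((1:ℝ)/2) * (2 * q) * y * ws ^ (2:ℕ)) := by ring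
    rw [e]; linarith [g0]
  have e2 : pcell2 q 2 2 1 0 y x 0 rayAC (roofR1 q ws) =
      ((1 - q) * (2 - q) * (1 - y) * (1 - x)) * ((2:ℝ) * ws + (-2:ℝ) * y * ws + (2:ℝ) * q + (-2:ℝ) * q * ws - (q * ws ^ (2:ℕ)) + (2:ℝ) * q * y * ws) := by
    simp only [pcell2, rimOp, opAC, opBC, opTD, opTa, opWa, opTb, opWb, Biv.lin3, Biv.add, Biv.smul, inputBiv, targetBiv, pairH, rayAC, roofR1, xwR, zwR]
    ring
  rw [e2]; exact mul_nonneg (mul_nonneg (mul_nonneg (mul_nonneg hq1c hq2c) hyc) hxc) hR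

/-- MIN word `(2, 2, 1)`, pair `(AC, One)`: `≥ 0` on `q ∈ [0,1/2]` (termwise Bernstein certificate, 1 coefficients after removing ['q', '(1 - q)', '(1 - y)', '(1 - x)']). [folklore] -/
theorem lqMin_AC_One_221 {q y x : ℝ} (hq0 : 0 ≤ q) (hq1 : q ≤ 1 / 2) (_hy0 : 0 ≤ y) (_hy1 : y ≤ 1) (_hx0 : 0 ≤ x) (_hx1 : x ≤ 1) :
    0 ≤ pcell2 q 2 2 1 0 y x 0 rayAC rayOne := by
  have hu : (0:ℝ) ≤ 2 * q := by linarith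
  have huc : (0:ℝ) ≤ 1 - 2 * q := by linarith
  have hq1c : (0:ℝ) ≤ 1 - q := by linarith
  have hq2c : (0:ℝ) ≤ 2 - q := by linarith
  have hyc : (0:ℝ) ≤ 1 - y := by linarith
  have hxc : (0:ℝ) ≤ 1 - x := by linarith
  have g0 : 0 ≤ (1:ℝ) * (1:ℝ) := by positivity
  have hR : 0 ≤ (1:ℝ) := by
    have e : (1:ℝ) =
      ((1:ℝ) * (1:ℝ)) := by ring
    rw [e]; linarith [g0]
  have e2 : pcell2 q 2 2 1 0 y x 0 rayAC rayOne =
      (q * (1 - q) * (1 - y) * (1 - x)) * ((1:ℝ)) := by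
    simp only [pcell2, rimOp, opAC, opBC, opTD, opTa, opWa, opTb, opWb, Biv.lin3, Biv.add, Biv.smul, inputBiv, targetBiv, pairH, rayAC, rayOne]
    ring
  rw [e2]; exact mul_nonneg (mul_nonneg (mul_nonneg (mul_nonneg hq0 hq1c) hyc) hxc) hR

/-- MIN word `(2, 2, 1)`, pair `(One, One)`: `≥ 0` on `q ∈ [0,1/2]` (termwise Bernstein certificate; the cell vanishes). [folklore] -/
theorem lqMin_One_One_221 {q y x : ℝ} (_hq0 : 0 ≤ q) (_hq1 : q ≤ 1 / 2) (_hy0 : 0 ≤ y) (_hy1 : y ≤ 1) (_hx0 : 0 ≤ x) (_hx1 : x ≤ 1) :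
    0 ≤ pcell2 q 2 2 1 0 y x 0 rayOne rayOne := by
  have e : pcell2 q 2 2 1 0 y x 0 rayOne rayOne = 0 := by
    simp only [pcell2, rimOp, opAC, opBC, opTD, opTa, opWa, opTb, opWb, Biv.lin3, Biv.add, Biv.smul, inputBiv, targetBiv, pairH, rayOne]
    ring
  rw [e]

/-- MIN word `(2, 2, 1)`, pair `(One, AC)`: `≥ 0` on `q ∈ [0,1/2]` (termwise Bernstein certificate, 5 coefficients after removing ['(1 - q)', '(1 - x)']). [folklore] -/
theorem lqMin_One_AC_221 {q y x : ℝ} (hq0 : 0 ≤ q) (hq1 : q ≤ 1 / 2) (_hy0 : 0 ≤ y) (_hy1 : y ≤ 1) (_hx0 : 0 ≤ x) (_hx1 : x ≤ 1) :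
    0 ≤ pcell2 q 2 2 1 0 y x 0 rayOne rayAC := by
  have hu : (0:ℝ) ≤ 2 * q := by linarith
  have huc : (0:ℝ) ≤ 1 - 2 * q := by linarith
  have hq1c : (0:ℝ) ≤ 1 - q := by linarith
  have hq2c : (0:ℝ) ≤ 2 - q := by linarith
  have hyc : (0:ℝ) ≤ 1 - y := by linarith
  have hxc : (0:ℝ) ≤ 1 - x := by linarith
  have g0 : 0 ≤ (2:ℝ) * (1 - 2 * q) * y * (1 - y) + (1:ℝ) * (1 - 2 * q) * y ^ (2:ℕ) + ((1:ℝ)/2) * (2 * q) * (1 - y) ^ (2:ℕ) + ((3:ℝ)/2) * (2 * q) * y * (1 - y) + ((1:ℝ)/2) * (2 * q) * y ^ (2:ℕ) := by positivity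
  have hR : 0 ≤ (2:ℝ) * y - (y ^ (2:ℕ)) + q + (-3:ℝ) * q * y + q * y ^ (2:ℕ) := by
    have e : (2:ℝ) * y - (y ^ (2:ℕ)) + q + (-3:ℝ) * q * y + q * y ^ (2:ℕ) =
      ((2:ℝ) * (1 - 2 * q) * y * (1 - y) + (1:ℝ) * (1 - 2 * q) * y ^ (2:ℕ) + ((1:ℝ)/2) * (2 * q) * (1 - y) ^ (2:ℕ) + ((3:ℝ)/2) * (2 * q) * y * (1 - y) + ((1:ℝ)/2) * (2 * q) * y ^ (2:ℕ)) := by ring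
    rw [e]; linarith [g0]
  have e2 : pcell2 q 2 2 1 0 y x 0 rayOne rayAC =
      ((1 - q) * (1 - x)) * ((2:ℝ) * y - (y ^ (2:ℕ)) + q + (-3:ℝ) * q * y + q * y ^ (2:ℕ)) := by
    simp only [pcell2, rimOp, opAC, opBC, opTD, opTa, opWa, opTb, opWb, Biv.lin3, Biv.add, Biv.smul, inputBiv, targetBiv, pairH, rayAC, rayOne]
    ring
  rw [e2]; exact mul_nonneg (mul_nonneg hq1c hxc) hR

/-- MIN word `(2, 2, 2)`, pair `(AC, R0)`: `≥ 0` on `q ∈ [0,1/2]` (termwise Bernstein certificate, 2 coefficients after removing ['(1 - q)', '(2 - q)', '(1 - y)', '(1 - x)', '(1 - ws)']). [folklore] -/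
theorem lqMin_AC_R0_222 {q y x ws : ℝ} (hq0 : 0 ≤ q) (hq1 : q ≤ 1 / 2) (_hy0 : 0 ≤ y) (_hy1 : y ≤ 1) (_hx0 : 0 ≤ x) (_hx1 : x ≤ 1) (_hws0 : 0 ≤ ws) (_hws1 : ws ≤ 1) :
    0 ≤ pcell2 q 2 2 2 0 y x 0 rayAC (roofR0 q ws) := by
  have hu : (0:ℝ) ≤ 2 * q := by linarith
  have huc : (0:ℝ) ≤ 1 - 2 * q := by linarith
  have hq1c : (0:ℝ) ≤ 1 - q := by linarith
  have hq2c : (0:ℝ) ≤ 2 - q := by linarith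
  have hyc : (0:ℝ) ≤ 1 - y := by linarith
  have hxc : (0:ℝ) ≤ 1 - x := by linarith
  have hwsc : (0:ℝ) ≤ 1 - ws := by linarith
  have g0 : 0 ≤ (1:ℝ) * (1 - ws) + (2:ℝ) * ws := by positivity
  have hR : 0 ≤ (1:ℝ) + ws := by
    have e : (1:ℝ) + ws =
      ((1:ℝ) * (1 - ws) + (2:ℝ) * ws) := by ring
    rw [e]; linarith [g0]
  have e2 : pcell2 q 2 2 2 0 y x 0 rayAC (roofR0 q ws) =
      ((1 - q) * (2 - q) * (1 - y) * (1 - x) * (1 - ws)) * ((1:ℝ) + ws) := by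
    simp only [pcell2, rimOp, opAC, opBC, opTa, opWa, opTb, opWb, Biv.lin3, Biv.add, Biv.smul, inputBiv, targetBiv, pairH, rayAC, roofR0, xwR, zwR]
    ring
  rw [e2]; exact mul_nonneg (mul_nonneg (mul_nonneg (mul_nonneg (mul_nonneg hq1c hq2c) hyc) hxc) hwsc) hR

/-- MIN word `(2, 2, 2)`, pair `(AC, R1)`: `≥ 0` on `q ∈ [0,1/2]` (termwise Bernstein certificate, 3 coefficients after removing ['(1 - q)', '(2 - q)', '(1 - y)', '(1 - x)']). [folklore] -/
theorem lqMin_AC_R1_222 {q y x ws : ℝ} (hq0 : 0 ≤ q) (hq1 : q ≤ 1 / 2) (_hy0 : 0 ≤ y) (_hy1 : y ≤ 1) (_hx0 : 0 ≤ x) (_hx1 : x ≤ 1) (_hws0 : 0 ≤ ws) (_hws1 : ws ≤ 1) :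
    0 ≤ pcell2 q 2 2 2 0 y x 0 rayAC (roofR1 q ws) := by
  have hu : (0:ℝ) ≤ 2 * q := by linarith
  have huc : (0:ℝ) ≤ 1 - 2 * q := by linarith
  have hq1c : (0:ℝ) ≤ 1 - q := by linarith
  have hq2c : (0:ℝ) ≤ 2 - q := by linarith
  have hyc : (0:ℝ) ≤ 1 - y := by linarith
  have hxc : (0:ℝ) ≤ 1 - x := by linarith
  have hwsc : (0:ℝ) ≤ 1 - ws := by linarith
  have g0 : 0 ≤ (2:ℝ) * (1 - ws) ^ (2:ℕ) + (4:ℝ) * ws * (1 - ws) + (1:ℝ) * ws ^ (2:ℕ) := by positivity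
  have hR : 0 ≤ (2:ℝ) - (ws ^ (2:ℕ)) := by
    have e : (2:ℝ) - (ws ^ (2:ℕ)) =
      ((2:ℝ) * (1 - ws) ^ (2:ℕ) + (4:ℝ) * ws * (1 - ws) + (1:ℝ) * ws ^ (2:ℕ)) := by ring
    rw [e]; linarith [g0]
  have e2 : pcell2 q 2 2 2 0 y x 0 rayAC (roofR1 q ws) =
      ((1 - q) * (2 - q) * (1 - y) * (1 - x)) * ((2:ℝ) - (ws ^ (2:ℕ))) := by
    simp only [pcell2, rimOp, opAC, opBC, opTa, opWa, opTb, opWb, Biv.lin3, Biv.add, Biv.smul, inputBiv, targetBiv, pairH, rayAC, roofR1, xwR, zwR]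
    ring
  rw [e2]; exact mul_nonneg (mul_nonneg (mul_nonneg (mul_nonneg hq1c hq2c) hyc) hxc) hR

/-- MIN word `(2, 2, 2)`, pair `(AC, One)`: `≥ 0` on `q ∈ [0,1/2]` (termwise Bernstein certificate, 1 coefficients after removing ['(1 - q)', '(1 - y)', '(1 - x)']). [folklore] -/
theorem lqMin_AC_One_222 {q y x : ℝ} (hq0 : 0 ≤ q) (hq1 : q ≤ 1 / 2) (_hy0 : 0 ≤ y) (_hy1 : y ≤ 1) (_hx0 : 0 ≤ x) (_hx1 : x ≤ 1) :
    0 ≤ pcell2 q 2 2 2 0 y x 0 rayAC rayOne := by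
  have hu : (0:ℝ) ≤ 2 * q := by linarith
  have huc : (0:ℝ) ≤ 1 - 2 * q := by linarith
  have hq1c : (0:ℝ) ≤ 1 - q := by linarith
  have hq2c : (0:ℝ) ≤ 2 - q := by linarith
  have hyc : (0:ℝ) ≤ 1 - y := by linarith
  have hxc : (0:ℝ) ≤ 1 - x := by linarith
  have g0 : 0 ≤ (1:ℝ) * (1:ℝ) := by positivity
  have hR : 0 ≤ (1:ℝ) := by
    have e : (1:ℝ) =
      ((1:ℝ) * (1:ℝ)) := by ring
    rw [e]; linarith [g0]
  have e2 : pcell2 q 2 2 2 0 y x 0 rayAC rayOne =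
      ((1 - q) * (1 - y) * (1 - x)) * ((1:ℝ)) := by
    simp only [pcell2, rimOp, opAC, opBC, opTa, opWa, opTb, opWb, Biv.lin3, Biv.add, Biv.smul, inputBiv, targetBiv, pairH, rayAC, rayOne]
    ring
  rw [e2]; exact mul_nonneg (mul_nonneg (mul_nonneg hq1c hyc) hxc) hR

/-- MIN word `(2, 2, 2)`, pair `(One, One)`: `≥ 0` on `q ∈ [0,1/2]` (termwise Bernstein certificate; the cell vanishes). [folklore] -/
theorem lqMin_One_One_222 {q y x : ℝ} (_hq0 : 0 ≤ q) (_hq1 : q ≤ 1 / 2) (_hy0 : 0 ≤ y) (_hy1 : y ≤ 1) (_hx0 : 0 ≤ x) (_hx1 : x ≤ 1) :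
    0 ≤ pcell2 q 2 2 2 0 y x 0 rayOne rayOne := by
  have e : pcell2 q 2 2 2 0 y x 0 rayOne rayOne = 0 := by
    simp only [pcell2, rimOp, opAC, opBC, opTa, opWa, opTb, opWb, Biv.lin3, Biv.add, Biv.smul, inputBiv, targetBiv, pairH, rayOne]
    ring
  rw [e]

/-- MIN word `(2, 2, 2)`, pair `(One, AC)`: `≥ 0` on `q ∈ [0,1/2]` (termwise Bernstein certificate, 1 coefficients after removing ['(1 - q)', '(1 - y)', '(1 - x)']). [folklore] -/
theorem lqMin_One_AC_222 {q y x : ℝ} (hq0 : 0 ≤ q) (hq1 : q ≤ 1 / 2) (_hy0 : 0 ≤ y) (_hy1 : y ≤ 1) (_hx0 : 0 ≤ x) (_hx1 : x ≤ 1) :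
    0 ≤ pcell2 q 2 2 2 0 y x 0 rayOne rayAC := by
  have hu : (0:ℝ) ≤ 2 * q := by linarith
  have huc : (0:ℝ) ≤ 1 - 2 * q := by linarith
  have hq1c : (0:ℝ) ≤ 1 - q := by linarith
  have hq2c : (0:ℝ) ≤ 2 - q := by linarith
  have hyc : (0:ℝ) ≤ 1 - y := by linarith
  have hxc : (0:ℝ) ≤ 1 - x := by linarith
  have g0 : 0 ≤ (1:ℝ) * (1:ℝ) := by positivity
  have hR : 0 ≤ (1:ℝ) := by
    have e : (1:ℝ) =
      ((1:ℝ) * (1:ℝ)) := by ring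
    rw [e]; linarith [g0]
  have e2 : pcell2 q 2 2 2 0 y x 0 rayOne rayAC =
      ((1 - q) * (1 - y) * (1 - x)) * ((1:ℝ)) := by
    simp only [pcell2, rimOp, opAC, opBC, opTa, opWa, opTb, opWb, Biv.lin3, Biv.add, Biv.smul, inputBiv, targetBiv, pairH, rayAC, rayOne]
    ring
  rw [e2]; exact mul_nonneg (mul_nonneg (mul_nonneg hq1c hyc) hxc) hR

end ThreeApex

end FK

end Summit.CriticalPhenomena.PercolationContinuityZ3.Theorems
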